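import Mathlib
import Summits.ValiantsHypothesis.ValiantsHypothesis.Statement
import Summits.ValiantsHypothesis.ValiantsHypothesis.Theorems.SoloInformedPencilWedge
import HarnessLib

/-!
# Pencil girth, part 2: one pair of pencils (soloist, s35)

`solo_pencil_pair`: for two pencils `W + q_a W`, `W + q_b W` realising the monomials with
exponents in `Ta`, `Tb` (a Sidon pair of value sets on which `W` has no support), the fibre
product of the two leaf maps has dimension `m ≥ |Ta| + |Tb| - dim W` and yields `C(m,2)` linearly
independent wedges inside `Z ⊇ W·W + T·W`, all supported on `Ta + Tb`.  The commutation of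
`q_a` and `q_b` is the only non-additive input.
-/

namespace Summit.ValiantsHypothesis.ValiantsHypothesis.Theorems

open Finset Polynomial Module
open scoped Pointwise

/-! ### One pair of pencils -/

/-- The heart of the matter: two pencils `W + q_a W ∋ X^e (e ∈ Ta)`, `W + q_b W ∋ X^e (e ∈ Tb)`
through the common line `W` produce `C(m,2)` independent wedges in the shared space `Z`,
`m ≥ |Ta| + |Tb| - dim W`, supported in `Ta + Tb`. -/
theorem solo_pencil_pair {F : Type*} [Field F] {W Z N : Submodule F F[X]}
    [FiniteDimensional F W]
    (hZ1 : ∀ y ∈ W, ∀ y' ∈ W, y * y' ∈ Z) (hZ2 : ∀ τ ∈ N, ∀ y ∈ W, τ * y ∈ Z)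
    {Ta Tb : Finset ℕ} (hNa : ∀ e ∈ Ta, (X : F[X]) ^ e ∈ N) (hNb : ∀ e ∈ Tb, (X : F[X]) ^ e ∈ N)
    (hS : ∀ u ∈ Ta, ∀ u' ∈ Tb, ∀ v ∈ Ta, ∀ v' ∈ Tb, u + u' = v + v' → u = v)
    (hWa : ∀ f ∈ W, f ∈ soloSuppIn F (Ta : Set ℕ) → f = 0)
    (hWb : ∀ f ∈ W, f ∈ soloSuppIn F (Tb : Set ℕ) → f = 0)
    {qa qb : F[X]} {xa wa : ↥Ta → F[X]} {xb wb : ↥Tb → F[X]}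
    (hxa : ∀ e, xa e ∈ W) (hwa : ∀ e, wa e ∈ W) (hxb : ∀ e, xb e ∈ W) (hwb : ∀ e, wb e ∈ W)
    (hqa : ∀ e, qa * xa e = wa e + X ^ (e : ℕ)) (hqb : ∀ e, qb * xb e = wb e + X ^ (e : ℕ)) :
    ∃ (m : ℕ) (f : {ij : Fin m × Fin m // ij.1 < ij.2} → F[X]),
      Ta.card + Tb.card ≤ m + finrank F W ∧ LinearIndependent F f ∧ (∀ k, f k ∈ Z) ∧
        (∀ k, f k ∈ soloSuppIn F ((Ta + Tb : Finset ℕ) : Set ℕ)) := by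
  classical
  set Λa := Fintype.linearCombination F (fun e : ↥Ta => (X : F[X]) ^ (e : ℕ)) with hΛa
  set Λb := Fintype.linearCombination F (fun e : ↥Tb => (X : F[X]) ^ (e : ℕ)) with hΛb
  set ξa := Fintype.linearCombination F xa with hξa
  set ξb := Fintype.linearCombination F xb with hξb
  set ωa := Fintype.linearCombination F wa with hωa
  set ωb := Fintype.linearCombination F wb with hωb
  have hΛa_supp : ∀ c, Λa c ∈ soloSuppIn F (Ta : Set ℕ) := fun c k hk => by
    rw [hΛa, solo_coeff_monComb, dif_neg (by simpa using hk)]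
  have hΛb_supp : ∀ c, Λb c ∈ soloSuppIn F (Tb : Set ℕ) := fun c k hk => by
    rw [hΛb, solo_coeff_monComb, dif_neg (by simpa using hk)]
  have hΛa_inj : ∀ c, Λa c = 0 → c = 0 := by
    intro c hc
    funext e
    have := congrArg (fun f : F[X] => f.coeff (e : ℕ)) hc
    simp only [hΛa, solo_coeff_monComb, dif_pos e.2, coeff_zero] at this
    simpa using this
  have hΛb_inj : ∀ c, Λb c = 0 → c = 0 := by
    intro c hc
    funext e
    have := congrArg (fun f : F[X] => f.coeff (e : ℕ)) hc
    simp only [hΛb, solo_coeff_monComb, dif_pos e.2, coeff_zero] at this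
    simpa using this
  have hΛa_N : ∀ c, Λa c ∈ N := fun c => by
    rw [hΛa, Fintype.linearCombination_apply]
    exact Submodule.sum_mem _ fun e _ => Submodule.smul_mem _ _ (hNa e e.2)
  have hΛb_N : ∀ c, Λb c ∈ N := fun c => by
    rw [hΛb, Fintype.linearCombination_apply]
    exact Submodule.sum_mem _ fun e _ => Submodule.smul_mem _ _ (hNb e e.2)
  have hlcW : ∀ {α : Type} [Fintype α] (v : α → F[X]), (∀ i, v i ∈ W) →
      ∀ c, Fintype.linearCombination F v c ∈ W := by
    intro α _ v hv c
    rw [Fintype.linearCombination_apply]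
    exact Submodule.sum_mem _ fun i _ => Submodule.smul_mem _ _ (hv i)
  have hξa_W : ∀ c, ξa c ∈ W := hlcW xa hxa
  have hξb_W : ∀ c, ξb c ∈ W := hlcW xb hxb
  have hωa_W : ∀ c, ωa c ∈ W := hlcW wa hwa
  have hωb_W : ∀ c, ωb c ∈ W := hlcW wb hwb
  have hqξa : ∀ c, qa * ξa c = ωa c + Λa c := by
    intro c
    simp only [hξa, hωa, hΛa, Fintype.linearCombination_apply, Finset.mul_sum, mul_smul_comm, hqa,
      smul_add, Finset.sum_add_distrib]
  have hqξb : ∀ c, qb * ξb c = ωb c + Λb c := by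
    intro c
    simp only [hξb, hωb, hΛb, Fintype.linearCombination_apply, Finset.mul_sum, mul_smul_comm, hqb,
      smul_add, Finset.sum_add_distrib]
  have hξa_inj : ∀ c, ξa c = 0 → c = 0 := by
    intro c hc
    apply hΛa_inj
    have h1 : Λa c = -ωa c := by
      have := hqξa c
      rw [hc, mul_zero] at this
      linear_combination -this
    exact hWa _ (by rw [h1]; exact W.neg_mem (hωa_W c)) (hΛa_supp c)
  have hξb_inj : ∀ c, ξb c = 0 → c = 0 := by
    intro c hc
    apply hΛb_inj
    have h1 : Λb c = -ωb c := by
      have := hqξb c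
      rw [hc, mul_zero] at this
      linear_combination -this
    exact hWb _ (by rw [h1]; exact W.neg_mem (hωb_W c)) (hΛb_supp c)
  -- the fibre product of the two leaf spans
  set δ : ((↥Ta → F) × (↥Tb → F)) →ₗ[F] F[X] :=
    ξa.comp (LinearMap.fst F (↥Ta → F) (↥Tb → F)) -
      ξb.comp (LinearMap.snd F (↥Ta → F) (↥Tb → F)) with hδ
  have hδ_apply : ∀ v : (↥Ta → F) × (↥Tb → F), δ v = ξa v.1 - ξb v.2 := fun v => rfl
  set Pf := LinearMap.ker δ with hPf
  have hrange : LinearMap.range δ ≤ W := by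
    rintro _ ⟨v, rfl⟩
    rw [hδ_apply]
    exact W.sub_mem (hξa_W _) (hξb_W _)
  have hdim : Ta.card + Tb.card ≤ finrank F Pf + finrank F W := by
    have h1 := LinearMap.finrank_range_add_finrank_ker δ
    rw [← hPf] at h1
    have h2 : finrank F ((↥Ta → F) × (↥Tb → F)) = Ta.card + Tb.card := by
      rw [Module.finrank_prod, Module.finrank_fintype_fun_eq_card,
        Module.finrank_fintype_fun_eq_card, Fintype.card_coe, Fintype.card_coe]
    have h3 : finrank F (LinearMap.range δ) ≤ finrank F W := Submodule.finrank_mono hrange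
    omega
  set m := finrank F Pf with hm
  set bP := Module.finBasis F Pf with hbP
  set cv : Fin m → (↥Ta → F) := fun i => ((bP i : Pf) : (↥Ta → F) × (↥Tb → F)).1 with hcv
  set dv : Fin m → (↥Tb → F) := fun i => ((bP i : Pf) : (↥Ta → F) × (↥Tb → F)).2 with hdv
  have hfib : ∀ i, ξa (cv i) = ξb (dv i) := by
    intro i
    have := LinearMap.mem_ker.mp (bP i).2
    rw [hδ_apply, sub_eq_zero] at this
    exact this
  set Av : Fin m → F[X] := fun i => Λa (cv i) with hAv
  set Bv : Fin m → F[X] := fun i => Λb (dv i) with hBv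
  have hAv_li : LinearIndependent F Av := by
    have hker : LinearMap.ker (Λa.comp ((LinearMap.fst F (↥Ta → F) (↥Tb → F)).comp Pf.subtype))
        = ⊥ := by
      rw [LinearMap.ker_eq_bot']
      intro v hv
      have h1 : ((v : Pf) : (↥Ta → F) × (↥Tb → F)).1 = 0 := hΛa_inj _ hv
      have h2 : ((v : Pf) : (↥Ta → F) × (↥Tb → F)).2 = 0 := by
        apply hξb_inj
        have := LinearMap.mem_ker.mp v.2
        rw [hδ_apply, h1, map_zero, zero_sub, neg_eq_zero] at this
        exact this
      exact Subtype.ext (Prod.ext h1 h2)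
    have key := bP.linearIndependent.map' _ hker
    have heq : (⇑(Λa.comp ((LinearMap.fst F (↥Ta → F) (↥Tb → F)).comp Pf.subtype)) ∘ ⇑bP)
        = Av := by
      funext i
      simp only [Function.comp_apply, LinearMap.comp_apply, LinearMap.fst_apply,
        Submodule.subtype_apply, hAv, hcv]
    rw [heq] at key
    exact key
  have hBv_li : LinearIndependent F Bv := by
    have hker : LinearMap.ker (Λb.comp ((LinearMap.snd F (↥Ta → F) (↥Tb → F)).comp Pf.subtype))
        = ⊥ := by
      rw [LinearMap.ker_eq_bot']
      intro v hv
      have h2 : ((v : Pf) : (↥Ta → F) × (↥Tb → F)).2 = 0 := hΛb_inj _ hv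
      have h1 : ((v : Pf) : (↥Ta → F) × (↥Tb → F)).1 = 0 := by
        apply hξa_inj
        have := LinearMap.mem_ker.mp v.2
        rw [hδ_apply, h2, map_zero, sub_zero] at this
        exact this
      exact Subtype.ext (Prod.ext h1 h2)
    have key := bP.linearIndependent.map' _ hker
    have heq : (⇑(Λb.comp ((LinearMap.snd F (↥Ta → F) (↥Tb → F)).comp Pf.subtype)) ∘ ⇑bP)
        = Bv := by
      funext i
      simp only [Function.comp_apply, LinearMap.comp_apply, LinearMap.snd_apply,
        Submodule.subtype_apply, hBv, hdv]
    rw [heq] at key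
    exact key
  have hAv_supp : ∀ i, ∀ k ∉ Ta, (Av i).coeff k = 0 := fun i k hk =>
    hΛa_supp (cv i) k (by simpa using hk)
  have hBv_supp : ∀ i, ∀ k ∉ Tb, (Bv i).coeff k = 0 := fun i k hk =>
    hΛb_supp (dv i) k (by simpa using hk)
  have hprod := solo_linearIndependent_mul hS hAv_li hBv_li hAv_supp hBv_supp
  have hwedge := solo_linearIndependent_wedge hprod
  refine ⟨m, fun k => Av k.1.1 * Bv k.1.2 - Av k.1.2 * Bv k.1.1, hdim, hwedge, ?_, ?_⟩
  · rintro ⟨⟨i, j⟩, _⟩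
    have h1 := hqξa (cv i)
    have h2 : qb * ξa (cv i) = ωb (dv i) + Λb (dv i) := by rw [hfib]; exact hqξb (dv i)
    have h3 := hqξa (cv j)
    have h4 : qb * ξa (cv j) = ωb (dv j) + Λb (dv j) := by rw [hfib]; exact hqξb (dv j)
    have hid : Λa (cv i) * Λb (dv j) - Λa (cv j) * Λb (dv i) =
        ωa (cv j) * ωb (dv i) + Λa (cv j) * ωb (dv i) + ωa (cv j) * Λb (dv i)
          - ωa (cv i) * ωb (dv j) - Λa (cv i) * ωb (dv j) - ωa (cv i) * Λb (dv j) := by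
      linear_combination (-(qb * ξa (cv j))) * h1 - (ωa (cv i) + Λa (cv i)) * h4
        + (qb * ξa (cv i)) * h3 + (ωa (cv j) + Λa (cv j)) * h2
    show Λa (cv i) * Λb (dv j) - Λa (cv j) * Λb (dv i) ∈ Z
    rw [hid]
    refine Z.sub_mem (Z.sub_mem (Z.sub_mem (Z.add_mem (Z.add_mem ?_ ?_) ?_) ?_) ?_) ?_
    · exact hZ1 _ (hωa_W _) _ (hωb_W _)
    · exact hZ2 _ (hΛa_N _) _ (hωb_W _)
    · rw [mul_comm]; exact hZ2 _ (hΛb_N _) _ (hωa_W _)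
    · exact hZ1 _ (hωa_W _) _ (hωb_W _)
    · exact hZ2 _ (hΛa_N _) _ (hωb_W _)
    · rw [mul_comm]; exact hZ2 _ (hΛb_N _) _ (hωa_W _)
  · intro k
    exact Submodule.sub_mem _ (mul_mem_soloSuppIn (hΛa_supp _) (hΛb_supp _))
      (mul_mem_soloSuppIn (hΛa_supp _) (hΛb_supp _))

end Summit.ValiantsHypothesis.ValiantsHypothesis.Theorems
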